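import Literature.AlgebraicGeometry.Resolution.FibreCone
import Literature.AlgebraicGeometry.Resolution.PsiBirationalChart
import Literature.AlgebraicGeometry.Resolution.CatenaryRings
import Literature.RingTheory.HilbertSamuel.LocalizedPolynomial
import Literature.AlgebraicGeometry.Resolution.BennettHironakaLocal
import Mathlib.RingTheory.Localization.LocalizationLocalization
import Mathlib.RingTheory.Localization.Algebra
import Mathlib.RingTheory.PolynomialAlgebra
import HarnessLib

/-!
# The local rings of the fibre of `Bl_𝔭(Spec 𝒪) → Spec 𝒪` are localizations of the fibre cone

Topic: `Literature/AlgebraicGeometry/Resolution`. Let `(𝒪, 𝔫, k)` be a local ring, `𝔭 ⊆ 𝒪` an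
ideal, `a ∈ 𝔭`, `C = (𝒪[𝔭t])_{(at)}` the chart ring of `Bl_𝔭(Spec 𝒪) = Proj 𝒪[𝔭t]` at `at`,
`P ⊆ C` a prime over `𝔫` (a point `x'` of the fibre `F = Proj(A)`, `A = 𝒪[𝔭t]/𝔫𝒪[𝔭t]` the fibre
cone of `FibreCone.lean`) and `𝒪' = C_P = 𝒪_{X',x'}`. This file PROVES the piece of commutative
algebra behind the second half of CJS (3.14) / HIO (31.1) (3):

> "`𝒪_{F,x'} = 𝒪_{X',x'}/𝔫𝒪_{X',x'}` is the homogeneous localization of the graded ring `A` at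
> the homogeneous prime `𝔓 ↔ x'`, so that, with Nagata's `A_𝔓 = (A_{(𝔓)})(T)` and
> `C_{X,D,x} = Spec(A)`: `H^{(·)}_{𝒪_{F,x'}(T)} = H^{(·)}_{A_𝔓}`" (HIO (31.1) (2), (3);
> CJS p. 46 "`F = Proj(A)` … `C_{X,D,x} = Spec(A)`", Lemma 2.27 for `R(T)`).

in the following TRANSPOSED form, which avoids homogeneous localizations at non-closed points:
**`𝒪'(X)/𝔫𝒪'(X) ≅ (A_𝔐)_𝔮`**, where `𝒪'(X) = 𝒪'[X]_{𝔪'[X]}` is Nagata's localized polynomial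
ring (`LocalizedPolynomial`, same Hilbert functions as `𝒪'`), `A_𝔐 = FibreConeLocal 𝔭` is the
local ring of the cone at its vertex and `𝔮 = coneLocalPrime a ha P` is the prime of `A_𝔐`
corresponding to `P` (the generic point of the line through `x'` in the cone). Indeed both sides
are the localization of `A` at the homogeneous prime `𝔓 = chartPrime a ha P / 𝔫` of `A`:
`𝒪[𝔭t]_{at} = C[X]_X` (`ReesAwayPolynomial.lean`), so `𝒪'(X) = C[X]_{P[X]}` is
`𝒪[𝔭t]` localized at the contraction `chartPrime P` of `P·𝒪[𝔭t]_{at}`, and reducing modulo `𝔫`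
commutes with localization.

Moreover (**the chain bound**, used to feed Bennett's inequality (30.2) in `A_𝔐` with the right
`d = dim A_𝔐/𝔮`): a chain of primes `P = P₀ ⊊ ⋯ ⊊ P_ℓ` of `C` gives the chain
`chartPrime P₀ ⊊ ⋯ ⊊ chartPrime P_ℓ ⊊ 𝔫 ⊕ 𝒪[𝔭t]₊` of `𝒪[𝔭t]`, whence
**`ℓ + 1 ≤ dim A_𝔐/𝔮`** (`length_succ_le_ringKrullDim_fibreConeLocal_quotient`); for `x'` closed
in the fibre this is `dim A_𝔐/𝔮 ≥ 1`, in general it is `≥ 1 + δ`, `δ = trdeg_k κ(x')`, in the form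
"`δ ≤` length of a chain from `x'` to a closed point of `F`" that the proof of Thm. 3.10 (1) uses.

## Main statements

* generic: `isLocalization_atPrime_quotient_mapExt_of_le` (`T/ET = (R/E)_{Q/E}` for `T = R_Q`,
  `E ⊆ Q`), `isLocalization_atPrime_localization_map_of_le` (`(A_𝔐)_{qA_𝔐} = A_q`),
  `nonempty_ringEquiv_localization_localization_quotient` (`((R/E)_𝔐)_p ≅ T/ET`),
  `ringKrullDim_localization_quotient_map_map` (`dim (R/E)_𝔐/p = ht(𝔐/(Q/E))`).
* `chartPrime a ha P ⊆ ReesRing 𝔭`, prime, `chartPrime_le_iff`, `reesMaxExt_le_chartPrime`,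
  `chartPrime_lt_reesVertex`; `conePrime`, `coneLocalPrime` (primes of `A`, `A_𝔐`).
* `length_succ_le_ringKrullDim_fibreConeLocal_quotient` — the chain bound.
* `isLocalization_atPrime_localizedPolynomial_chartPrime` — `𝒪'(X)` is `𝒪[𝔭t]` localized at
  `chartPrime P`; `nonempty_ringEquiv_coneLocal_localizedPolynomial_quotient` —
  **`(A_𝔐)_𝔮 ≃+* 𝒪'(X)/𝔫𝒪'(X)`**; `hilbertSamuelFun_localizedPolynomial_quotient_eq` — hence
  `H^{(t)}[𝒪'(X)/𝔫𝒪'(X)] = H^{(t)}[(A_𝔐)_𝔮]`.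

No named facts are introduced.

## Sources

* V. Cossart, U. Jannsen, S. Saito, LNM 2270 (2020), proof of Thm. 3.10, (3.14) and p. 46;
  Lemma 2.27. [CossartJannsenSaito2020]
* M. Herrmann, S. Ikeda, U. Orbanz, *Equimultiplicity and Blowing up* (1988), Thm. (31.1),
  proof, displays (1)–(3); (12.13) (charts of blowing ups). [HerrmannIkedaOrbanz1988]
* The Stacks Project, Tag 0804 (affine blowup algebras and `Proj` of the Rees algebra),
  Tag 02LY (localization commutes with quotients). [StacksProject]
-/

noncomputable section

open Polynomial IsLocalRing Literature.RingTheory.HilbertSamuel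

namespace Literature.AlgebraicGeometry.Resolution

universe u

/-! ## Generic: localizing at a prime commutes with quotients and with a first localization -/

section Generic

variable {R₀ : Type u} [CommRing R₀] {E Q : Ideal R₀} [Q.IsPrime]

/-- `Q/E` is a prime of `R₀/E` for a prime `Q ⊇ E`. [folklore] -/
theorem isPrime_map_quotientMk_of_le (hEQ : E ≤ Q) : (Q.map (Ideal.Quotient.mk E)).IsPrime :=
  Ideal.map_isPrime_of_surjective Ideal.Quotient.mk_surjective (by rwa [Ideal.mk_ker])

/-- The image of `R₀ ∖ Q` in `R₀/E` is `(R₀/E) ∖ (Q/E)` for `E ⊆ Q`. [folklore] -/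
theorem algebraMapSubmonoid_primeCompl_eq_of_le (hEQ : E ≤ Q) :
    haveI := isPrime_map_quotientMk_of_le hEQ
    Algebra.algebraMapSubmonoid (R₀ ⧸ E) Q.primeCompl =
      (Q.map (Ideal.Quotient.mk E)).primeCompl := by
  ext x
  constructor
  · rintro ⟨s, hs, rfl⟩ hx
    have h := Ideal.mem_quotient_iff_mem_sup.mp hx
    rw [sup_eq_left.mpr hEQ] at h
    exact hs h
  · intro hx
    obtain ⟨s, rfl⟩ := Ideal.Quotient.mk_surjective x
    exact ⟨s, fun hs => hx (Ideal.mem_map_of_mem _ hs), rfl⟩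

/-- **`T/ET` is the localization of `R₀/E` at `Q/E`** when `T` is the localization of `R₀` at a
prime `Q ⊇ E` (localization commutes with quotients, Stacks 02LY). [folklore] -/
theorem isLocalization_atPrime_quotient_mapExt_of_le (hEQ : E ≤ Q) (T : Type u) [CommRing T]
    [Algebra R₀ T] [IsLocalization.AtPrime T Q] :
    haveI := isPrime_map_quotientMk_of_le hEQ
    IsLocalization.AtPrime (T ⧸ E.map (algebraMap R₀ T)) (Q.map (Ideal.Quotient.mk E)) := by
  have h : IsLocalization (Algebra.algebraMapSubmonoid (R₀ ⧸ E) Q.primeCompl)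
      (T ⧸ E.map (algebraMap R₀ T)) := inferInstance
  rwa [algebraMapSubmonoid_primeCompl_eq_of_le hEQ] at h

variable {A : Type u} [CommRing A] {q : Ideal A} [q.IsPrime] (𝔐 : Ideal A) [𝔐.IsPrime]

/-- `q A_𝔐` is a prime of `A_𝔐` for primes `q ⊆ 𝔐`. [folklore] -/
theorem isPrime_map_localization_atPrime_of_le (hq𝔐 : q ≤ 𝔐) :
    (q.map (algebraMap A (Localization.AtPrime 𝔐))).IsPrime := by
  refine IsLocalization.isPrime_of_isPrime_disjoint 𝔐.primeCompl (Localization.AtPrime 𝔐) q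
    inferInstance ?_
  rw [Set.disjoint_left]
  intro r hr hrq
  exact hr (hq𝔐 hrq)

/-- `q A_𝔐 ∩ A = q` for primes `q ⊆ 𝔐`. [folklore] -/
theorem under_map_localization_atPrime_of_le (hq𝔐 : q ≤ 𝔐) :
    (q.map (algebraMap A (Localization.AtPrime 𝔐))).comap
      (algebraMap A (Localization.AtPrime 𝔐)) = q := by
  refine IsLocalization.under_map_of_isPrime_disjoint 𝔐.primeCompl (Localization.AtPrime 𝔐)
    inferInstance ?_
  rw [Set.disjoint_left]
  intro r hr hrq
  exact hr (hq𝔐 hrq)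

/-- **`(A_𝔐)_{q A_𝔐}` is the localization of `A` at `q`** (`q ⊆ 𝔐` primes). [folklore] -/
theorem isLocalization_atPrime_localization_map_of_le (hq𝔐 : q ≤ 𝔐) :
    haveI := isPrime_map_localization_atPrime_of_le 𝔐 hq𝔐
    IsLocalization.AtPrime
      (Localization.AtPrime (q.map (algebraMap A (Localization.AtPrime 𝔐)))) q := by
  haveI := isPrime_map_localization_atPrime_of_le 𝔐 hq𝔐
  have h1 : IsLocalization.AtPrime
      (Localization.AtPrime (q.map (algebraMap A (Localization.AtPrime 𝔐))))
      ((q.map (algebraMap A (Localization.AtPrime 𝔐))).comap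
        (algebraMap A (Localization.AtPrime 𝔐))) := inferInstance
  have hM : q.primeCompl = ((q.map (algebraMap A (Localization.AtPrime 𝔐))).comap
        (algebraMap A (Localization.AtPrime 𝔐))).primeCompl := by
    ext r
    change r ∉ q ↔ r ∉ (q.map (algebraMap A (Localization.AtPrime 𝔐))).comap
        (algebraMap A (Localization.AtPrime 𝔐))
    rw [under_map_localization_atPrime_of_le 𝔐 hq𝔐]
  change IsLocalization q.primeCompl _
  rw [hM]
  exact h1

/-- **`((R₀/E)_𝔐)_p ≅ T/ET`** for `T = (R₀)_Q`, `E ⊆ Q`, `𝔐 ⊇ Q/E` a prime of `R₀/E` and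
`p = (Q/E)·(R₀/E)_𝔐`: both are the localization of `R₀/E` at `Q/E`. [folklore] -/
theorem nonempty_ringEquiv_localization_localization_quotient (hEQ : E ≤ Q) (T : Type u)
    [CommRing T] [Algebra R₀ T] [IsLocalization.AtPrime T Q] (𝔐 : Ideal (R₀ ⧸ E)) [𝔐.IsPrime]
    (hQ𝔐 : Q.map (Ideal.Quotient.mk E) ≤ 𝔐) :
    haveI := isPrime_map_quotientMk_of_le hEQ
    haveI := isPrime_map_localization_atPrime_of_le 𝔐 hQ𝔐
    Nonempty (Localization.AtPrime ((Q.map (Ideal.Quotient.mk E)).map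
      (algebraMap (R₀ ⧸ E) (Localization.AtPrime 𝔐))) ≃+* T ⧸ E.map (algebraMap R₀ T)) := by
  haveI := isPrime_map_quotientMk_of_le hEQ
  haveI := isPrime_map_localization_atPrime_of_le 𝔐 hQ𝔐
  haveI h1 := isLocalization_atPrime_localization_map_of_le 𝔐 hQ𝔐
  haveI h2 := isLocalization_atPrime_quotient_mapExt_of_le hEQ T
  exact ⟨(IsLocalization.algEquiv (Q.map (Ideal.Quotient.mk E)).primeCompl
    (Localization.AtPrime ((Q.map (Ideal.Quotient.mk E)).map
      (algebraMap (R₀ ⧸ E) (Localization.AtPrime 𝔐))))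
    (T ⧸ E.map (algebraMap R₀ T))).toRingEquiv⟩

/-- `dim ((R₀/E)_𝔐 / (Q/E)(R₀/E)_𝔐) = ht(𝔐/(Q/E))` (in `(R₀/E)/(Q/E)`). [folklore] -/
theorem ringKrullDim_localization_quotient_map_map (hEQ : E ≤ Q) (𝔐 : Ideal (R₀ ⧸ E))
    [𝔐.IsPrime] (hQ𝔐 : Q.map (Ideal.Quotient.mk E) ≤ 𝔐) :
    haveI := isPrime_map_quotientMk_of_le hEQ
    ringKrullDim (Localization.AtPrime 𝔐 ⧸ (Q.map (Ideal.Quotient.mk E)).map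
      (algebraMap (R₀ ⧸ E) (Localization.AtPrime 𝔐))) =
      (𝔐.map (Ideal.Quotient.mk (Q.map (Ideal.Quotient.mk E)))).height := by
  haveI := isPrime_map_quotientMk_of_le hEQ
  exact ringKrullDim_quotient_map_eq_height (R₀ ⧸ E) 𝔐 (Localization.AtPrime 𝔐) hQ𝔐

/-- **Chains above the kernel bound the height in the quotient**: for a surjection `σ : B → S`
onto a domain and a strict chain of primes `J₀ ⊊ ⋯ ⊊ J_n` of `B` with `J₀ = ker σ` and
`J_n = σ⁻¹(𝔐)`, `𝔐` a prime of `S`, one has `n ≤ ht 𝔐`. [folklore] -/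
theorem length_le_height_of_ltSeries_comap {B S : Type u} [CommRing B] [CommRing S] [IsDomain S]
    (σ : B →+* S) (hσ : Function.Surjective σ) (𝔐 : Ideal S) [𝔐.IsPrime]
    (u : LTSeries (PrimeSpectrum B)) (hu0 : u.head.asIdeal = RingHom.ker σ)
    (hu1 : u.last.asIdeal = 𝔐.comap σ) : (u.length : ℕ∞) ≤ 𝔐.height := by
  obtain ⟨F, hF, -, hFx⟩ := exists_orderEmbedding_of_surjective σ hσ
  have hta : u.head = F ⟨⊥, Ideal.isPrime_bot⟩ := by
    refine PrimeSpectrum.ext ?_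
    rw [hu0, hFx]
    change RingHom.ker σ = Ideal.comap σ ⊥
    exact RingHom.ker_eq_comap_bot σ
  have htb : u.last = F ⟨𝔐, ‹_›⟩ := by
    refine PrimeSpectrum.ext ?_
    rw [hu1, hFx]
    rfl
  obtain ⟨s, -, hsb, hlen, -⟩ := exists_ltSeries_lift F hF u hta htb
  have h := Order.length_le_height_last (p := s)
  rw [hsb, ← PrimeSpectrum.height_eq_orderHeight, hlen] at h
  exact h

end Generic

/-! ## The primes of `𝒪[𝔭t]`, of the fibre cone and of its local ring attached to a point of a chart -/

section ChartPrimes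

variable {O : Type u} [CommRing O] {𝔭 : Ideal O} (a : O) (ha : a ∈ 𝔭)

local notation3 "𝒞" => HomogeneousLocalization.Away (reesGrading 𝔭) (reesT a ha)
local notation3 "𝓛" => Localization.Away (reesT a ha)
local notation3 "ιC" => (algebraMap (HomogeneousLocalization.Away (reesGrading 𝔭) (reesT a ha))
  (Localization.Away (reesT a ha)) :
    HomogeneousLocalization.Away (reesGrading 𝔭) (reesT a ha) →+* Localization.Away (reesT a ha))
local notation3 "ιR" => (algebraMap (reesAlgebra 𝔭) (Localization.Away (reesT a ha)) :
    reesAlgebra 𝔭 →+* Localization.Away (reesT a ha))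

/-- **The homogeneous prime `𝔓 ⊆ 𝒪[𝔭t]` of a point `P` of the chart `D₊(at)`**: the contraction
of `P · 𝒪[𝔭t]_{at}` to `𝒪[𝔭t]` (so `D₊(at) ∩ V₊(𝔓) = ` the closure of the point `P`).
[cite: StacksProject, Tag 0804] -/
def chartPrime (P : Ideal 𝒞) : Ideal (ReesRing 𝔭) :=
  ((P.map ιC).comap ιR).comap (ReesRing.equiv 𝔭)

/-- Membership: `b ∈ 𝔓 ↔ b ∈ P·𝒪[𝔭t]_{at}`. [folklore] -/
theorem mem_chartPrime_iff (P : Ideal 𝒞) (b : ReesRing 𝔭) :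
    b ∈ chartPrime a ha P ↔ ιR (ReesRing.equiv 𝔭 b) ∈ P.map ιC := Iff.rfl

/-- **Homogeneity**: `b ∈ 𝔓 ↔` every coefficient `b_d t^d/(at)^d` lies in `P`.
[cite: StacksProject, Tag 0804] -/
theorem mem_chartPrime_iff_awayCoeff (P : Ideal 𝒞) [P.IsPrime] (b : ReesRing 𝔭) :
    b ∈ chartPrime a ha P ↔ ∀ d, awayCoeff a ha (ReesRing.equiv 𝔭 b) d ∈ P :=
  mem_comap_map_away_iff a ha P (ReesRing.equiv 𝔭 b)

/-- `𝔓` is prime. [folklore] -/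
instance isPrime_chartPrime (P : Ideal 𝒞) [P.IsPrime] : (chartPrime a ha P).IsPrime := by
  haveI := isPrime_map_away a ha P
  exact Ideal.comap_isPrime _ _

/-- `𝔓(P) ⊆ 𝔓(P') ↔ P ⊆ P'`. [folklore] -/
theorem chartPrime_le_iff {P P' : Ideal 𝒞} [P.IsPrime] [P'.IsPrime] :
    chartPrime a ha P ≤ chartPrime a ha P' ↔ P ≤ P' := by
  rw [chartPrime, chartPrime,
    Ideal.comap_le_comap_iff_of_surjective (ReesRing.equiv 𝔭) (ReesRing.equiv 𝔭).surjective]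
  exact comap_map_away_le_iff a ha

/-- `P ↦ 𝔓(P)` is injective on primes. [folklore] -/
theorem chartPrime_injective {P P' : Ideal 𝒞} [P.IsPrime] [P'.IsPrime]
    (h : chartPrime a ha P = chartPrime a ha P') : P = P' :=
  le_antisymm ((chartPrime_le_iff a ha).mp h.le) ((chartPrime_le_iff a ha).mp h.ge)

/-- An element `r ∈ 𝒪 ⊆ 𝒪[𝔭t]` lies in `𝔓` iff `r/1 ∈ P`. [folklore] -/
theorem algebraMap_mem_chartPrime_iff (P : Ideal 𝒞) [P.IsPrime] (r : O) :
    algebraMap O (ReesRing 𝔭) r ∈ chartPrime a ha P ↔ reesChartBase a ha r ∈ P :=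
  algebraMap_mem_comap_map_away_iff a ha P r

/-- The constant coefficient of an element of `𝔓` maps into `P`. [folklore] -/
theorem reesChartBase_constCoeff_mem (P : Ideal 𝒞) [P.IsPrime] {b : ReesRing 𝔭}
    (hb : b ∈ chartPrime a ha P) : reesChartBase a ha (ReesRing.constCoeff 𝔭 b) ∈ P :=
  reesChartBase_coeff_zero_mem_of_mem_comap_map_away a ha P hb

/-- `at ∉ 𝔓` (it is inverted on the chart). [folklore] -/
theorem tMonomial_one_notMem_chartPrime (P : Ideal 𝒞) [P.IsPrime] :
    ReesRing.tMonomial 𝔭 1 a (by rw [pow_one]; exact ha) ∉ chartPrime a ha P :=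
  reesT_notMem_comap_map_away a ha P

/-- The map `Spec C → Spec 𝒪[𝔭t]`, `P ↦ 𝔓(P)`. [cite: StacksProject, Tag 0804] -/
def chartPrimeSpec (P : PrimeSpectrum 𝒞) : PrimeSpectrum (ReesRing 𝔭) :=
  ⟨chartPrime a ha P.asIdeal, inferInstance⟩

/-- `P ↦ 𝔓(P)` is strictly monotone. [folklore] -/
theorem chartPrimeSpec_strictMono : StrictMono (chartPrimeSpec (𝔭 := 𝔭) a ha) := by
  intro P P' h
  change chartPrime a ha P.asIdeal < chartPrime a ha P'.asIdeal
  rw [lt_iff_le_not_ge, chartPrime_le_iff, chartPrime_le_iff]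
  exact lt_iff_le_not_ge.mp h

variable [IsLocalRing O]

/-- A prime of the chart containing a prime over `𝔫` lies over `𝔫`. [folklore] -/
theorem comap_reesChartBase_eq_of_le {P P' : Ideal 𝒞} [P'.IsPrime]
    (hP : P.comap (reesChartBase a ha) = maximalIdeal O) (hPP' : P ≤ P') :
    P'.comap (reesChartBase a ha) = maximalIdeal O :=
  ((IsLocalRing.maximalIdeal.isMaximal O).eq_of_le (Ideal.IsPrime.ne_top inferInstance)
    (hP ▸ Ideal.comap_mono hPP')).symm

/-- **`𝔫 𝒪[𝔭t] ⊆ 𝔓`** for `P` over `𝔫`. [folklore] -/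
theorem reesMaxExt_le_chartPrime (P : Ideal 𝒞) [P.IsPrime]
    (hP : P.comap (reesChartBase a ha) = maximalIdeal O) : reesMaxExt 𝔭 ≤ chartPrime a ha P := by
  refine Ideal.map_le_iff_le_comap.mpr fun r hr => ?_
  rw [Ideal.mem_comap, algebraMap_mem_chartPrime_iff, ← Ideal.mem_comap, hP]
  exact hr

/-- **`𝔓 ⊆ 𝔫 ⊕ 𝒪[𝔭t]₊`** for `P` over `𝔫` (the constant coefficients of `𝔓` lie in `𝔫`).
[folklore] -/
theorem chartPrime_le_reesVertex (P : Ideal 𝒞) [P.IsPrime]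
    (hP : P.comap (reesChartBase a ha) = maximalIdeal O) : chartPrime a ha P ≤ reesVertex 𝔭 := by
  intro b hb
  rw [mem_reesVertex_iff, ← ReesRing.constCoeff_apply, ← hP, Ideal.mem_comap]
  exact reesChartBase_constCoeff_mem a ha P hb

/-- `at ∈ 𝔫 ⊕ 𝒪[𝔭t]₊`. [folklore] -/
theorem tMonomial_one_mem_reesVertex :
    ReesRing.tMonomial 𝔭 1 a (by rw [pow_one]; exact ha) ∈ reesVertex 𝔭 := by
  rw [mem_reesVertex_iff, ReesRing.poly_tMonomial, coeff_monomial, if_neg one_ne_zero]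
  exact zero_mem _

/-- **`𝔓 ⊊ 𝔫 ⊕ 𝒪[𝔭t]₊`**: the vertex is a proper specialization of every point of the fibre.
[folklore] -/
theorem chartPrime_lt_reesVertex (P : Ideal 𝒞) [P.IsPrime]
    (hP : P.comap (reesChartBase a ha) = maximalIdeal O) : chartPrime a ha P < reesVertex 𝔭 := by
  refine lt_of_le_of_ne (chartPrime_le_reesVertex a ha P hP) fun h => ?_
  have hmem := tMonomial_one_mem_reesVertex (𝔭 := 𝔭) a ha
  rw [← h] at hmem
  exact tMonomial_one_notMem_chartPrime a ha P hmem

/-- **The prime `𝔓/𝔫 ⊆ A = 𝒪[𝔭t]/𝔫𝒪[𝔭t]` of the fibre cone attached to `P`** (the homogeneous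
prime of `A` whose point of `Proj(A) = F` is `x' ↔ P`).
[cite: CossartJannsenSaito2020, Thm. 3.10 (proof, p. 46)] -/
def conePrime (P : Ideal 𝒞) : Ideal (FibreCone 𝔭) :=
  (chartPrime a ha P).map (Ideal.Quotient.mk (reesMaxExt 𝔭))

/-- `𝔓/𝔫` is prime. [folklore] -/
theorem isPrime_conePrime (P : Ideal 𝒞) [P.IsPrime]
    (hP : P.comap (reesChartBase a ha) = maximalIdeal O) : (conePrime a ha P).IsPrime :=
  isPrime_map_quotientMk_of_le (reesMaxExt_le_chartPrime a ha P hP)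

/-- `𝔓/𝔫` lies in the vertex of the cone. [folklore] -/
theorem conePrime_le_fibreConeVertex (P : Ideal 𝒞) [P.IsPrime]
    (hP : P.comap (reesChartBase a ha) = maximalIdeal O) :
    conePrime a ha P ≤ fibreConeVertex 𝔭 :=
  Ideal.map_mono (chartPrime_le_reesVertex a ha P hP)

/-- **The prime `𝔮 = (𝔓/𝔫) · A_𝔐` of the local ring of the cone at its vertex attached to `P`.**
[cite: CossartJannsenSaito2020, Thm. 3.10 (proof, (3.14))] -/
def coneLocalPrime (P : Ideal 𝒞) : Ideal (FibreConeLocal 𝔭) :=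
  (conePrime a ha P).map (algebraMap (FibreCone 𝔭) (FibreConeLocal 𝔭))

/-- `𝔮` is prime. [folklore] -/
theorem isPrime_coneLocalPrime (P : Ideal 𝒞) [P.IsPrime]
    (hP : P.comap (reesChartBase a ha) = maximalIdeal O) : (coneLocalPrime a ha P).IsPrime :=
  haveI := isPrime_conePrime a ha P hP
  isPrime_map_localization_atPrime_of_le (fibreConeVertex 𝔭) (conePrime_le_fibreConeVertex a ha P hP)

/-- `dim A_𝔐/𝔮 = ht(vertex/(𝔓/𝔫))` in `A/(𝔓/𝔫)`. [folklore] -/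
theorem ringKrullDim_fibreConeLocal_quotient_eq_height (P : Ideal 𝒞) [P.IsPrime]
    (hP : P.comap (reesChartBase a ha) = maximalIdeal O) :
    haveI := isPrime_conePrime a ha P hP
    ringKrullDim (FibreConeLocal 𝔭 ⧸ coneLocalPrime a ha P) =
      ((fibreConeVertex 𝔭).map (Ideal.Quotient.mk (conePrime a ha P))).height :=
  ringKrullDim_localization_quotient_map_map (reesMaxExt_le_chartPrime a ha P hP)
    (fibreConeVertex 𝔭) (conePrime_le_fibreConeVertex a ha P hP)

/-- **The chain bound `ℓ + 1 ≤ dim A_𝔐/𝔮`**: a strict chain of primes `P = P₀ ⊊ P₁ ⊊ ⋯ ⊊ P_ℓ` of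
the chart ring gives the strict chain `𝔓(P₀) ⊊ ⋯ ⊊ 𝔓(P_ℓ) ⊊ 𝔫 ⊕ 𝒪[𝔭t]₊` above `𝔓(P) ⊇ 𝔫𝒪[𝔭t]`,
i.e. a chain of length `ℓ + 1` in `Spec(A_𝔐/𝔮)`. (For the proof of Thm. 3.10 (1): `ℓ = δ` steps
from `x'` up to a closed point of the fibre, then the vertex.)
[cite: CossartJannsenSaito2020, Thm. 3.10 (proof, (3.14))] -/
theorem length_succ_le_ringKrullDim_fibreConeLocal_quotient (P : Ideal 𝒞) [P.IsPrime]
    (hP : P.comap (reesChartBase a ha) = maximalIdeal O) (t : LTSeries (PrimeSpectrum 𝒞))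
    (ht : t.head.asIdeal = P) :
    ((t.length + 1 : ℕ) : WithBot ℕ∞) ≤ ringKrullDim (FibreConeLocal 𝔭 ⧸ coneLocalPrime a ha P) := by
  haveI := isPrime_conePrime a ha P hP
  rw [ringKrullDim_fibreConeLocal_quotient_eq_height a ha P hP]
  -- the chain `𝔓(P₀) ⊊ ⋯ ⊊ 𝔓(P_ℓ) ⊊ vertex` in `Spec 𝒪[𝔭t]`
  haveI hlast : t.last.asIdeal.IsPrime := t.last.2
  have hPlast : P ≤ t.last.asIdeal := by
    rw [← ht]
    exact t.monotone (Fin.zero_le _)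
  have hlt : (t.map (chartPrimeSpec a ha) (chartPrimeSpec_strictMono a ha)).last <
      ⟨reesVertex 𝔭, (isMaximal_reesVertex 𝔭).isPrime⟩ := by
    rw [LTSeries.last_map]
    exact chartPrime_lt_reesVertex a ha t.last.asIdeal (comap_reesChartBase_eq_of_le a ha hP hPlast)
  let u : LTSeries (PrimeSpectrum (ReesRing 𝔭)) :=
    (t.map (chartPrimeSpec a ha) (chartPrimeSpec_strictMono a ha)).snoc _ hlt
  -- the surjection `σ : 𝒪[𝔭t] → A/(𝔓/𝔫)` with kernel `𝔓`
  let σ : ReesRing 𝔭 →+* FibreCone 𝔭 ⧸ conePrime a ha P :=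
    (Ideal.Quotient.mk (conePrime a ha P)).comp (Ideal.Quotient.mk (reesMaxExt 𝔭))
  have hσ : Function.Surjective σ :=
    Ideal.Quotient.mk_surjective.comp Ideal.Quotient.mk_surjective
  have hker : RingHom.ker σ = chartPrime a ha P := by
    rw [← RingHom.comap_ker, Ideal.mk_ker, conePrime,
      Ideal.comap_map_of_surjective _ Ideal.Quotient.mk_surjective, ← RingHom.ker_eq_comap_bot,
      Ideal.mk_ker, sup_eq_left]
    exact reesMaxExt_le_chartPrime a ha P hP
  haveI : ((fibreConeVertex 𝔭).map (Ideal.Quotient.mk (conePrime a ha P))).IsPrime :=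
    isPrime_map_quotientMk_of_le (conePrime_le_fibreConeVertex a ha P hP)
  have hlen : u.length = t.length + 1 := rfl
  have key := length_le_height_of_ltSeries_comap σ hσ
    ((fibreConeVertex 𝔭).map (Ideal.Quotient.mk (conePrime a ha P))) u ?_ ?_
  · rw [hlen] at key
    exact_mod_cast key
  · -- head: `𝔓(P₀) = 𝔓(P) = ker σ`
    rw [RelSeries.head_snoc, LTSeries.head_map, hker]
    change chartPrime a ha t.head.asIdeal = _
    rw [ht]
  · -- last: the vertex `= σ⁻¹(vertex / (𝔓/𝔫))`
    rw [RelSeries.last_snoc]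
    change reesVertex 𝔭 = _
    rw [← Ideal.comap_comap, Ideal.comap_map_of_surjective _ Ideal.Quotient.mk_surjective,
      ← RingHom.ker_eq_comap_bot, Ideal.mk_ker,
      sup_eq_left.mpr (conePrime_le_fibreConeVertex a ha P hP), comap_mk_fibreConeVertex]

end ChartPrimes

/-! ## `𝒪'(X) = 𝒪'[X]_{𝔪'[X]}` is `𝒪[𝔭t]` localized at `𝔓`, and `𝒪'(X)/𝔫𝒪'(X) ≅ (A_𝔐)_𝔮` -/

section Nagata

variable {O : Type u} [CommRing O] {𝔭 : Ideal O} (a : O) (ha : a ∈ 𝔭)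

local notation3 "𝒞" => HomogeneousLocalization.Away (reesGrading 𝔭) (reesT a ha)
local notation3 "𝓛" => Localization.Away (reesT a ha)
local notation3 "ιC" => (algebraMap (HomogeneousLocalization.Away (reesGrading 𝔭) (reesT a ha))
  (Localization.Away (reesT a ha)) :
    HomogeneousLocalization.Away (reesGrading 𝔭) (reesT a ha) →+* Localization.Away (reesT a ha))
local notation3 "ιR" => (algebraMap (reesAlgebra 𝔭) (Localization.Away (reesT a ha)) :
    reesAlgebra 𝔭 →+* Localization.Away (reesT a ha))
local notation3 "ιP" => (algebraMap (Polynomial (HomogeneousLocalization.Away (reesGrading 𝔭) (reesT a ha)))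
  (Localization.Away (reesT a ha)) :
    Polynomial (HomogeneousLocalization.Away (reesGrading 𝔭) (reesT a ha)) →+*
      Localization.Away (reesT a ha))

variable (P : Ideal (HomogeneousLocalization.Away (reesGrading 𝔭) (reesT a ha))) [P.IsPrime]
variable (O' : Type u) [CommRing O']
  [Algebra (HomogeneousLocalization.Away (reesGrading 𝔭) (reesT a ha)) O']
  [IsLocalization.AtPrime O' P] [IsLocalRing O']

local notation3 "𝓝" => LocalizedPolynomial O'
-- the structure map `C → 𝒪'`, bundled (elaboration aid)
local notation3 "φ'" => (algebraMap (HomogeneousLocalization.Away (reesGrading 𝔭) (reesT a ha)) O' :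
  HomogeneousLocalization.Away (reesGrading 𝔭) (reesT a ha) →+* O')

attribute [local instance] Polynomial.algebra awayPolyAlgebra

/-- `X ∉ P[X]`: the powers of `X` miss `P[X]`. [folklore] -/
theorem powers_X_le_primeCompl_map_C :
    Submonoid.powers (X : 𝒞[X]) ≤ (P.map (C : 𝒞 →+* 𝒞[X])).primeCompl := by
  rintro _ ⟨n, rfl⟩ h
  have h' : (X ^ n : 𝒞[X]).coeff n ∈ P := (Ideal.mem_map_C_iff.mp h) n
  rw [coeff_X_pow_self] at h'
  exact (Ideal.IsPrime.ne_top inferInstance) (Ideal.eq_top_of_isUnit_mem _ h' isUnit_one)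

/-- `(I[X]) ∩_{f} R[X] = (f⁻¹ I)[X]` for a ring map `f : R → S` and an ideal `I ⊆ S`. [folklore] -/
theorem comap_mapRingHom_map_C {R S : Type u} [CommRing R] [CommRing S] (f : R →+* S)
    (I : Ideal S) : (I.map (C : S →+* S[X])).comap (mapRingHom f) = (I.comap f).map C := by
  ext p
  rw [Ideal.mem_comap, Ideal.mem_map_C_iff, Ideal.mem_map_C_iff]
  refine forall_congr' fun n => ?_
  rw [coe_mapRingHom, coeff_map, Ideal.mem_comap]

/-- **`𝒪'(X) = 𝒪'[X]_{𝔪'[X]}` is the localization of `C[X]` at `P[X]`** (`𝒪' = C_P`).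
[cite: CossartJannsenSaito2020, Lemma 2.27] -/
theorem isLocalization_atPrime_localizedPolynomial_map_C :
    IsLocalization.AtPrime 𝓝 (P.map (C : 𝒞 →+* 𝒞[X])) := by
  haveI := Polynomial.isLocalization P.primeCompl O'
  have h := IsLocalization.isLocalization_isLocalization_atPrime_isLocalization
    (P.primeCompl.map (C : 𝒞 →+* 𝒞[X])) (T := 𝓝) ((maximalIdeal O').map (C : O' →+* O'[X]))
  have hcomap : ((maximalIdeal O').map (C : O' →+* O'[X])).comap (algebraMap 𝒞[X] O'[X]) =
      P.map (C : 𝒞 →+* 𝒞[X]) := by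
    rw [Polynomial.algebraMap_def, comap_mapRingHom_map_C, ← Ideal.under_def,
      IsLocalization.AtPrime.under_maximalIdeal O' P]
  have hM : (P.map (C : 𝒞 →+* 𝒞[X])).primeCompl =
      (((maximalIdeal O').map (C : O' →+* O'[X])).comap (algebraMap 𝒞[X] O'[X])).primeCompl := by
    ext r
    change r ∉ P.map (C : 𝒞 →+* 𝒞[X]) ↔
      r ∉ ((maximalIdeal O').map (C : O' →+* O'[X])).comap (algebraMap 𝒞[X] O'[X])
    rw [hcomap]
  change IsLocalization (P.map (C : 𝒞 →+* 𝒞[X])).primeCompl 𝓝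
  rw [hM]
  exact h

/-- The `L`-algebra structure `𝒪[𝔭t]_{at} = C[X]_X → 𝒪'(X) = C[X]_{P[X]}` (`X ∉ P[X]`); it
depends on `P`, so it is not an instance but is activated by `letI` where needed. [folklore] -/
@[reducible] def awayLocalizedPolynomialAlgebra : Algebra 𝓛 𝓝 :=
  haveI := isLocalization_awayPoly a ha
  haveI := isLocalization_atPrime_localizedPolynomial_map_C a ha P O'
  IsLocalization.localizationAlgebraOfSubmonoidLe 𝓛 𝓝 (Submonoid.powers (X : 𝒞[X]))
    (P.map (C : 𝒞 →+* 𝒞[X])).primeCompl (powers_X_le_primeCompl_map_C a ha P)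

/-- `C[X] → L → 𝒪'(X)` is `C[X] → 𝒪'(X)`. [folklore] -/
theorem isScalarTower_awayLocalizedPolynomial :
    letI := awayLocalizedPolynomialAlgebra a ha P O'
    IsScalarTower 𝒞[X] 𝓛 𝓝 :=
  haveI := isLocalization_awayPoly a ha
  haveI := isLocalization_atPrime_localizedPolynomial_map_C a ha P O'
  IsLocalization.localization_isScalarTower_of_submonoid_le 𝓛 𝓝 (Submonoid.powers (X : 𝒞[X]))
    (P.map (C : 𝒞 →+* 𝒞[X])).primeCompl (powers_X_le_primeCompl_map_C a ha P)

/-- **`𝒪'(X)` is the localization of `L = 𝒪[𝔭t]_{at}` at `P L`.** [folklore] -/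
theorem isLocalization_atPrime_localizedPolynomial_map_away :
    letI := awayLocalizedPolynomialAlgebra a ha P O'
    haveI := isPrime_map_away a ha P
    IsLocalization.AtPrime 𝓝 (P.map ιC) := by
  letI := awayLocalizedPolynomialAlgebra a ha P O'
  haveI := isPrime_map_away a ha P
  haveI := isLocalization_awayPoly a ha
  haveI := isLocalization_atPrime_localizedPolynomial_map_C a ha P O'
  haveI := isScalarTower_awayLocalizedPolynomial a ha P O'
  have h3 : IsLocalization (((P.map (C : 𝒞 →+* 𝒞[X])).primeCompl).map ιP) 𝓝 :=
    IsLocalization.isLocalization_of_submonoid_le 𝓛 𝓝 (Submonoid.powers (X : 𝒞[X]))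
      (P.map (C : 𝒞 →+* 𝒞[X])).primeCompl (powers_X_le_primeCompl_map_C a ha P)
  refine @IsLocalization.of_le_of_exists_dvd _ _ _ _ _ _ h3 _ ?_ ?_
  · -- images of polynomials outside `P[X]` lie outside `P L`
    rintro _ ⟨q, hq, rfl⟩ hmem
    have hq' : q ∈ (P.map ιC).comap ιP := hmem
    rw [comap_awayPolyHom_map_away] at hq'
    exact hq hq'
  · -- every `z ∉ P L` divides such an image: `z (at)ⁿ = θ(q)`
    intro z hz
    obtain ⟨n, q, hzq⟩ := exists_mul_pow_eq_awayPolyHom a ha z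
    have hq : q ∉ P.map (C : 𝒞 →+* 𝒞[X]) := by
      intro hq
      have hθq : awayPolyHom a ha q ∈ P.map ιC :=
        (awayPolyHom_mem_map_away_iff a ha P q).mpr (Ideal.mem_map_C_iff.mp hq)
      rw [← hzq] at hθq
      rcases (Ideal.IsPrime.mem_or_mem inferInstance hθq) with h | h
      · exact hz h
      · exact (Ideal.IsPrime.ne_top inferInstance) (Ideal.eq_top_of_isUnit_mem _
          (Ideal.IsPrime.mem_of_pow_mem inferInstance n h)
          (IsLocalization.Away.algebraMap_isUnit (reesT a ha)))
    refine ⟨awayPolyHom a ha q, ⟨q, hq, (algebraMap_awayPolyAlgebra a ha q).symm⟩, ?_⟩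
    exact Dvd.intro _ hzq

/-- The `𝒪[𝔭t]`-algebra structure on `L = 𝒪[𝔭t]_{at}` through the copy `ReesRing 𝔭`. [folklore] -/
@[reducible] def reesRingAwayAlgebra : Algebra (ReesRing 𝔭) 𝓛 :=
  ((algebraMap (reesAlgebra 𝔭) (Localization.Away (reesT a ha))).comp
    (ReesRing.equiv 𝔭).toRingHom).toAlgebra

attribute [local instance] reesRingAwayAlgebra

/-- Unfolding. [folklore] -/
theorem algebraMap_reesRingAway (b : ReesRing 𝔭) :
    algebraMap (ReesRing 𝔭) 𝓛 b = ιR (ReesRing.equiv 𝔭 b) := rfl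

omit [P.IsPrime] in
/-- `L` is the localization of `ReesRing 𝔭` away from `at`. [folklore] -/
theorem isLocalization_away_reesRing :
    IsLocalization (Submonoid.powers ((ReesRing.equiv 𝔭).symm (reesT a ha))) 𝓛 := by
  have h := IsLocalization.isLocalization_of_base_ringEquiv (Submonoid.powers (reesT a ha)) 𝓛
    (ReesRing.equiv 𝔭).symm
  rw [Submonoid.map_powers] at h
  exact h

omit [P.IsPrime] in
/-- `𝔓 = (P L) ∩ 𝒪[𝔭t]` along `ReesRing 𝔭 → L`. [folklore] -/
theorem chartPrime_eq_comap :
    chartPrime a ha P = (P.map ιC).comap (algebraMap (ReesRing 𝔭) 𝓛) := by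
  rw [chartPrime, RingHom.algebraMap_toAlgebra, ← Ideal.comap_coe (ReesRing.equiv 𝔭),
    Ideal.comap_comap]
  rfl

/-- The `𝒪[𝔭t]`-algebra structure on `𝒪'(X)`: `𝒪[𝔭t] → L → 𝒪'(X)` (depends on `P`; activated
by `letI`). [folklore] -/
@[reducible] def reesRingLocalizedPolynomialAlgebra : Algebra (ReesRing 𝔭) 𝓝 :=
  letI := awayLocalizedPolynomialAlgebra a ha P O'
  ((algebraMap 𝓛 𝓝).comp (algebraMap (ReesRing 𝔭) 𝓛)).toAlgebra

/-- `𝒪[𝔭t] → L → 𝒪'(X)` is a tower. [folklore] -/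
theorem isScalarTower_reesRing_away_localizedPolynomial :
    letI := awayLocalizedPolynomialAlgebra a ha P O'
    letI := reesRingLocalizedPolynomialAlgebra a ha P O'
    IsScalarTower (ReesRing 𝔭) 𝓛 𝓝 :=
  letI := awayLocalizedPolynomialAlgebra a ha P O'
  letI := reesRingLocalizedPolynomialAlgebra a ha P O'
  IsScalarTower.of_algebraMap_eq' rfl

/-- **`𝒪'(X)` is the localization of `𝒪[𝔭t]` at the homogeneous prime `𝔓` of `P`.**
[cite: HerrmannIkedaOrbanz1988, Thm. (31.1) (proof, (2))] -/
theorem isLocalization_atPrime_localizedPolynomial_chartPrime :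
    letI := reesRingLocalizedPolynomialAlgebra a ha P O'
    IsLocalization.AtPrime 𝓝 (chartPrime a ha P) := by
  letI := awayLocalizedPolynomialAlgebra a ha P O'
  letI := reesRingLocalizedPolynomialAlgebra a ha P O'
  haveI := isPrime_map_away a ha P
  haveI := isLocalization_away_reesRing (𝔭 := 𝔭) a ha
  haveI := isLocalization_atPrime_localizedPolynomial_map_away a ha P O'
  haveI := isScalarTower_reesRing_away_localizedPolynomial a ha P O'
  have h := IsLocalization.isLocalization_isLocalization_atPrime_isLocalization
    (Submonoid.powers ((ReesRing.equiv 𝔭).symm (reesT a ha))) (T := 𝓝) (P.map ιC)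
  have hM : (chartPrime a ha P).primeCompl =
      ((P.map ιC).comap (algebraMap (ReesRing 𝔭) 𝓛)).primeCompl := by
    ext r
    change r ∉ chartPrime a ha P ↔ r ∉ (P.map ιC).comap (algebraMap (ReesRing 𝔭) 𝓛)
    rw [chartPrime_eq_comap]
  change IsLocalization (chartPrime a ha P).primeCompl 𝓝
  rw [hM]
  exact h

variable [IsLocalRing O] [Algebra O O']

omit [IsLocalRing O] in
/-- Along `𝒪 → 𝒪[𝔭t] → L → 𝒪'(X)` an element `r ∈ 𝒪` goes to `r ∈ 𝒪' ⊆ 𝒪'(X)`, provided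
`𝒪 → 𝒪'` is `𝒪 → C → 𝒪'`. [folklore] -/
theorem algebraMap_reesRing_localizedPolynomial_algebraMap
    (hOO' : ∀ r : O, algebraMap O O' r = φ' (reesChartBase a ha r)) (r : O) :
    letI := reesRingLocalizedPolynomialAlgebra a ha P O'
    algebraMap (ReesRing 𝔭) 𝓝 (algebraMap O (ReesRing 𝔭) r) = algebraMap O 𝓝 r := by
  letI := awayLocalizedPolynomialAlgebra a ha P O'
  letI := reesRingLocalizedPolynomialAlgebra a ha P O'
  haveI := isScalarTower_awayLocalizedPolynomial a ha P O'
  have h1 : algebraMap (ReesRing 𝔭) 𝓛 (algebraMap O (ReesRing 𝔭) r) =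
      ιP (C (reesChartBase a ha r)) := by
    rw [algebraMap_reesRingAway, algebraMap_awayPolyAlgebra, awayPolyHom_C, algebraMap_away_eq_val,
      val_reesChartBase, Localization.mk_one_eq_algebraMap]
    rfl
  change algebraMap 𝓛 𝓝 (algebraMap (ReesRing 𝔭) 𝓛 (algebraMap O (ReesRing 𝔭) r)) = _
  rw [h1, ← IsScalarTower.algebraMap_apply 𝒞[X] 𝓛 𝓝,
    IsScalarTower.algebraMap_apply 𝒞[X] O'[X] 𝓝, Polynomial.algebraMap_def, coe_mapRingHom,
    map_C, ← hOO', IsScalarTower.algebraMap_apply O O'[X] 𝓝, Polynomial.algebraMap_apply]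

/-- **`𝔫𝒪[𝔭t] · 𝒪'(X) = 𝔫 𝒪'(X)`.** [folklore] -/
theorem map_reesMaxExt_localizedPolynomial
    (hOO' : ∀ r : O, algebraMap O O' r = φ' (reesChartBase a ha r)) :
    letI := reesRingLocalizedPolynomialAlgebra a ha P O'
    (reesMaxExt 𝔭).map (algebraMap (ReesRing 𝔭) 𝓝) = (maximalIdeal O).map (algebraMap O 𝓝) := by
  letI := reesRingLocalizedPolynomialAlgebra a ha P O'
  rw [reesMaxExt, Ideal.map_map]
  congr 1
  exact RingHom.ext fun r => algebraMap_reesRing_localizedPolynomial_algebraMap a ha P O' hOO' r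

/-- **`(A_𝔐)_𝔮 ≅ 𝒪'(X)/𝔫𝒪'(X)`** — the local ring of the fibre `F = π⁻¹(x)` at `x'`, after
Nagata's `(T)`, is the local ring of the cone `C_{X,D,x} = Spec A` at the generic point `𝔮` of the
line of `x'`, i.e. `A_𝔐` localized at `𝔮` (`A_𝔐` the local ring at the vertex).
[cite: CossartJannsenSaito2020, Thm. 3.10 (proof, (3.14), p. 46)]
[cite: HerrmannIkedaOrbanz1988, Thm. (31.1) (proof, (2)–(3))] -/
theorem nonempty_ringEquiv_coneLocal_localizedPolynomial_quotient
    (hP : P.comap (reesChartBase a ha) = maximalIdeal O)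
    (hOO' : ∀ r : O, algebraMap O O' r = φ' (reesChartBase a ha r)) :
    haveI := isPrime_coneLocalPrime a ha P hP
    Nonempty (Localization.AtPrime (coneLocalPrime a ha P) ≃+*
      𝓝 ⧸ (maximalIdeal O).map (algebraMap O 𝓝)) := by
  letI := reesRingLocalizedPolynomialAlgebra a ha P O'
  haveI := isLocalization_atPrime_localizedPolynomial_chartPrime a ha P O'
  obtain ⟨e⟩ := nonempty_ringEquiv_localization_localization_quotient
    (reesMaxExt_le_chartPrime a ha P hP) 𝓝 (fibreConeVertex 𝔭)
    (conePrime_le_fibreConeVertex a ha P hP)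
  exact ⟨e.trans (Ideal.quotEquivOfEq (map_reesMaxExt_localizedPolynomial a ha P O' hOO'))⟩

/-- `𝔫 𝒪'(X) ⊆ 𝔪_{𝒪'(X)}` when `𝒪 → 𝒪' = C_P` with `P` over `𝔫`. [folklore] -/
theorem map_maximalIdeal_localizedPolynomial_le
    (hP : P.comap (reesChartBase a ha) = maximalIdeal O)
    (hOO' : ∀ r : O, algebraMap O O' r = φ' (reesChartBase a ha r)) :
    (maximalIdeal O).map (algebraMap O 𝓝) ≤ maximalIdeal 𝓝 := by
  refine Ideal.map_le_iff_le_comap.mpr fun r hr => ?_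
  rw [Ideal.mem_comap, IsScalarTower.algebraMap_apply O O' 𝓝, ← map_maximalIdeal_localizedPolynomial]
  refine Ideal.mem_map_of_mem _ ?_
  rw [hOO', IsLocalization.AtPrime.to_map_mem_maximal_iff O' P, ← Ideal.mem_comap, hP]
  exact hr

/-- `𝒪'(X)/𝔫𝒪'(X)` is a local ring. [folklore] -/
theorem isLocalRing_localizedPolynomial_quotient
    (hP : P.comap (reesChartBase a ha) = maximalIdeal O)
    (hOO' : ∀ r : O, algebraMap O O' r = φ' (reesChartBase a ha r)) :
    IsLocalRing (𝓝 ⧸ (maximalIdeal O).map (algebraMap O 𝓝)) := by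
  have hne : (maximalIdeal O).map (algebraMap O 𝓝) ≠ ⊤ := fun h =>
    (IsLocalRing.maximalIdeal.isMaximal 𝓝).ne_top
      (top_le_iff.mp (h ▸ map_maximalIdeal_localizedPolynomial_le a ha P O' hP hOO'))
  haveI : Nontrivial (𝓝 ⧸ (maximalIdeal O).map (algebraMap O 𝓝)) :=
    Ideal.Quotient.nontrivial_iff.mpr hne
  exact IsLocalRing.of_surjective' (Ideal.Quotient.mk _) Ideal.Quotient.mk_surjective

/-- **`H^{(t)}[𝒪'(X)/𝔫𝒪'(X)] = H^{(t)}[(A_𝔐)_𝔮]`** for every `t` (`𝒪` Noetherian).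
[cite: CossartJannsenSaito2020, Thm. 3.10 (proof, (3.14))]
[cite: HerrmannIkedaOrbanz1988, Thm. (31.1) (proof, (3))] -/
theorem hilbertSamuelFun_localizedPolynomial_quotient_eq [IsNoetherianRing O]
    (hP : P.comap (reesChartBase a ha) = maximalIdeal O)
    (hOO' : ∀ r : O, algebraMap O O' r = φ' (reesChartBase a ha r)) (t : ℕ) :
    haveI := isLocalRing_localizedPolynomial_quotient a ha P O' hP hOO'
    haveI := isPrime_coneLocalPrime a ha P hP
    hilbertSamuelFun (𝓝 ⧸ (maximalIdeal O).map (algebraMap O 𝓝)) t =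
      hilbertSamuelFun (Localization.AtPrime (coneLocalPrime a ha P)) t := by
  haveI := isLocalRing_localizedPolynomial_quotient a ha P O' hP hOO'
  haveI := isPrime_coneLocalPrime a ha P hP
  obtain ⟨e⟩ := nonempty_ringEquiv_coneLocal_localizedPolynomial_quotient a ha P O' hP hOO'
  exact (hilbertSamuelFun_congr_ringEquiv e t).symm

end Nagata

end Literature.AlgebraicGeometry.Resolution

end
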